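import Summits.AnomalousDissipation.AnomalousDissipation.Theses.EnsembleRigidity
import Summits.AnomalousDissipation.AnomalousDissipation.Theorems.GPStatisticalRigidity.Negative.LoadBearing
import Literature.Analysis.FluidPDE.StatisticalSolutionProofs

/-!
# `EnsembleRigidity.GPStatisticalRigidity` (stmt-AnomalousDissipation-15508): the energy-integrability
# hypothesis is redundant — negative side (hypothesis mutation)

cdisprove seat `refuter-cdisprove-stmt-AnomalousDissipation-15508-0` (2026-08-16). Dropping the hypothesis
`Integrable (fun v => ‖v‖²) μ` does NOT change the crux: it follows from the finite-mean-enstrophy clause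
`ensembleEnstrophy μ < ⊤` by the spectral Poincaré inequality on the mean-zero space `H`
(`Torus.enorm_sq_le_eGradNormSq`, `‖v‖² ≤ ‖∇v‖²`) and the measurability of the spectral enstrophy density
(`Torus.measurable_eGradNormSq_coe`). So `RigidAt f E c δ₀` (the `∀ μ` body of the crux) is equivalent to
the same statement with that hypothesis deleted (`rigidAtNoInt_iff`): provers may assume it for free, refuters
gain nothing by violating it. Nothing here asserts a Theses statement.
-/

noncomputable section

open MeasureTheory UnitAddTorus
open scoped InnerProductSpace ENNReal

set_option linter.dupNamespace false

namespace Summit.AnomalousDissipation.AnomalousDissipation.Theorems.GPStatisticalRigidity.Negative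

open Literature.Analysis.FunctionSpaces Literature.Analysis.FunctionSpaces.Torus Literature.Analysis.FluidPDE
open Summit.AnomalousDissipation.AnomalousDissipation.Theses.EnsembleRigidity

/-- **Finite mean enstrophy forces integrable energy** on `H` (Poincaré): for a finite measure `μ` on `H` with
`∫⁻ ‖∇v‖² dμ < ∞`, `v ↦ ‖v‖²` is `μ`-integrable. -/
theorem integrable_norm_sq_of_ensembleEnstrophy_lt_top
    (μ : Measure (Torus.energySpace (Fin 3))) [IsFiniteMeasure μ] (hG : Torus.ensembleEnstrophy μ < ⊤) :
    Integrable (fun v : Torus.energySpace (Fin 3) => ‖v‖ ^ 2) μ := by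
  have hmeas := (Torus.measurable_eGradNormSq_coe (d := Fin 3))
  have hint : Integrable (fun v : Torus.energySpace (Fin 3) =>
      (eGradNormSq ((v : Lp (EuclideanSpace ℝ (Fin 3)) 2 (volume : Measure (UnitAddTorus (Fin 3)))) :
        UnitAddTorus (Fin 3) → EuclideanSpace ℝ (Fin 3))).toReal) μ :=
    integrable_toReal_of_lintegral_ne_top hmeas.aemeasurable hG.ne
  refine hint.mono' ((continuous_norm.pow 2).aestronglyMeasurable) ?_
  filter_upwards [ae_lt_top hmeas hG.ne] with v hv
  rw [Real.norm_of_nonneg (by positivity)]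
  have hP := Torus.enorm_sq_le_eGradNormSq v
  calc ‖v‖ ^ 2 = (‖v‖ₑ ^ 2).toReal := by rw [ENNReal.toReal_pow, toReal_enorm]
    _ ≤ _ := ENNReal.toReal_mono hv.ne hP

/-- The `∀ μ` body of the crux with the hypothesis `Integrable ‖v‖²` DELETED. -/
def RigidAtNoInt (f : UnitAddTorus (Fin 3) → EuclideanSpace ℝ (Fin 3)) (E c δ₀ : ℝ) : Prop :=
  ∀ μ : Measure (Torus.energySpace (Fin 3)), IsProbabilityMeasure μ →
    Torus.ensembleEnergy μ ≤ E → Torus.ensembleEnstrophy μ < ⊤ → ShellWorkNonneg f μ →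
      ∀ R : ℝ, 0 ≤ R → R ≤ δ₀ → DefectLE f μ R → c ≤ R * Real.sqrt (Torus.ensembleEnstrophy μ).toReal

/-- **The energy-integrability hypothesis is redundant**: deleting it yields an equivalent statement. -/
theorem rigidAtNoInt_iff (f : UnitAddTorus (Fin 3) → EuclideanSpace ℝ (Fin 3)) (E c δ₀ : ℝ) :
    RigidAtNoInt f E c δ₀ ↔ RigidAt f E c δ₀ := by
  constructor
  · exact fun h μ hμ _ hE hG hS R hR0 hRδ hD => h μ hμ hE hG hS R hR0 hRδ hD
  · intro h μ hμ hE hG hS R hR0 hRδ hD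
    exact h μ hμ (integrable_norm_sq_of_ensembleEnstrophy_lt_top μ hG) hE hG hS R hR0 hRδ hD

/-- Hence the crux itself is equivalent to its version without the integrability clause, level by level. -/
theorem crux_iff_noInt :
    GPStatisticalRigidity ↔ ∀ E : ℝ, ∃ c δ₀ : ℝ, 0 < c ∧ 0 < δ₀ ∧ RigidAtNoInt gpForce E c δ₀ := by
  constructor
  · intro h E
    obtain ⟨c, δ₀, hc, hδ₀, hrig⟩ := rigid_of_crux h E
    exact ⟨c, δ₀, hc, hδ₀, (rigidAtNoInt_iff _ _ _ _).2 hrig⟩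
  · intro h f hf E
    subst hf
    obtain ⟨c, δ₀, hc, hδ₀, hrig⟩ := h E
    exact ⟨c, δ₀, hc, hδ₀, fun μ hμ hI hE hG hS R hR0 hRδ hD =>
      (rigidAtNoInt_iff _ _ _ _).1 hrig μ hμ hI hE hG hS R hR0 hRδ hD⟩

end Summit.AnomalousDissipation.AnomalousDissipation.Theorems.GPStatisticalRigidity.Negative
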